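import Mathlib
import HarnessLib
import Summits.Ventures.LatticeQCDFlow.Scaling.LinearFamilyStepMGF
import Summits.Ventures.LatticeQCDFlow.Scaling.TiltedProtocolMass

/-!
# LinearFamilyStepMGFTwoSided — the one-step log-MGF `Λ_{c,δ}(t)` of the linear protocol is pinned
# between the two parabolas `½t(t−1)δ²σ_min²` and `½t(t−1)δ²σ̄²` on ALL of `ℝ` when
# `σ_min² ≤ Var_c(D) ≤ σ̄²` for every `c`; hence `e^{a²σ_min²} − 1 ≤ χ²(π_{c+a} ‖ π_c) ≤ e^{a²σ̄²} − 1`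

HONEST FRAMING: exact (Metropolis-corrected) sampling algorithms for lattice gauge theory;
figures of merit are autocorrelation/cost numbers at stated couplings and volumes; no
continuum-physics claim.

Venture `LatticeQCDFlow` (cell pub-lqcd), topic `Scaling`; FANOUT row 19 (`su2-snf`, GEN-10).
OUR WORK (one-variable calculus on row 8's thermodynamic integration), nothing cited as a fact.
`Scaling/LinearFamilyStepMGF` (this seat, GEN-6) proved the UPPER parabola off `(0,1)`
(`stepLogMGF_le_of_varD_le`) and `Λ ≤ 0` on `[0,1]` (`stepLogMGF_nonpos`) — the two one-sided facts
the work-MGF envelopes need.  This file completes the picture (`Λ'' = δ²·Var_{c+tδ}(D)`):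

* **`stepLogMGF_ge_of_varD_le`** — a variance CEILING also bounds `Λ` from BELOW on `[0,1]`:
  `½t(t−1)δ²σ̄² ≤ Λ_{c,δ}(t)` for `0 ≤ t ≤ 1` (the function `Λ(t) − ½t(t−1)δ²σ̄²` is concave with
  zeros at `0, 1`, hence non-negative between them) — the Rényi divergences of order `t ∈ (0,1)`
  between neighbouring levels (Bhattacharyya at `t = ½`) are at most `½t(1−t)δ²σ̄²`;
* **`stepLogMGF_ge_of_le_varD`** / **`stepLogMGF_le_of_le_varD`** — a variance FLOOR
  `σ_min² ≤ Var_c(D)` gives the mirror pair: `½t(t−1)δ²σ_min² ≤ Λ(t)` off `(0,1)` and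
  `Λ(t) ≤ ½t(t−1)δ²σ_min²` on `[0,1]` (`Λ − ½t(t−1)δ²σ_min²` is convex with the same zeros);
* **`chiSqDiv_gibbsLaw_linAction_ge`** — with `Scaling/TiltedProtocolMass.chiSqDiv_gibbsLaw_linAction_eq`
  (`χ² = e^{Λ(2)} − 1`): `e^{a²σ_min²} − 1 ≤ χ²(π_{c+a} ‖ π_c)`, the floor matching
  `chiSqDiv_gibbsLaw_linAction_le`; so the one-step reweighting ESS `1/(1+χ²)` of a switch of size
  `a` lies in `[e^{−a²σ̄²}, e^{−a²σ_min²}]`.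

Reading: every Jensen gap of the free energy along the family — the coefficients of the `χ²`,
entropy and hypercontractive envelopes of this row are all of this form — is two-sidedly
controlled by the variance profile of the switch observable; the lower parabola on `[0,1]` is the
input a windowed (`L^{p'} → L⁴`) refinement of `Scaling/HypercontractiveTiltedMass` would need
(HANDOFF GEN-10 (d2)).  NOT CLAIMED: windowed hypotheses (variance bounds on a sub-interval of
levels only); anything about layers.
-/

namespace Summit.Ventures.LatticeQCDFlow.Scaling

open Set
open Literature.Probability.ImportanceSampling (chiSqDiv)
open Summit.Ventures.LatticeQCDFlow.Exactness
open Summit.Ventures.LatticeQCDFlow.Theory2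

variable {X : Type*} [Fintype X] [Nonempty X]

/-- The shifted log-MGF `ψ_B(t) = Λ_{c,δ}(t) − ½t(t−1)·B` has second derivative
`δ²Var_{c+tδ}(D) − B` (packaged as the two `HasDerivAt` facts used below). -/
theorem hasDerivAt_stepLogMGF_sub_parabola (S₀ D : X → ℝ) (c δ B t : ℝ) :
    HasDerivAt (fun t => stepLogMGF S₀ D c δ t - t * (t - 1) / 2 * B)
      ((-(meanD S₀ D (c + t * δ) * δ) - (linFreeEnergy S₀ D c - linFreeEnergy S₀ D (c + δ)))
        - (2 * t - 1) / 2 * B) t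
    ∧ HasDerivAt (fun t => (-(meanD S₀ D (c + t * δ) * δ)
        - (linFreeEnergy S₀ D c - linFreeEnergy S₀ D (c + δ))) - (2 * t - 1) / 2 * B)
      (δ ^ 2 * varD S₀ D (c + t * δ) - B) t := by
  constructor
  · have hq : HasDerivAt (fun t : ℝ => t * (t - 1) / 2 * B) ((2 * t - 1) / 2 * B) t := by
      have h := (((hasDerivAt_id t).mul ((hasDerivAt_id t).sub_const 1)).div_const 2).mul_const B
      refine h.congr_deriv ?_
      simp only [id]; ring
    exact (hasDerivAt_stepLogMGF S₀ D c δ t).sub hq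
  · have hlin : HasDerivAt (fun t : ℝ => c + t * δ) δ t := by
      simpa using ((hasDerivAt_id t).mul_const δ).const_add c
    have hm := (hasDerivAt_meanD S₀ D (c + t * δ)).comp t hlin
    have hl : HasDerivAt (fun t : ℝ => (2 * t - 1) / 2 * B) (2 / 2 * B) t := by
      have := ((((hasDerivAt_id t).const_mul 2).sub_const 1).div_const 2).mul_const B
      simpa using this
    have h := (((hm.mul_const δ).neg).sub (hasDerivAt_const t
      (linFreeEnergy S₀ D c - linFreeEnergy S₀ D (c + δ)))).sub hl
    exact h.congr_deriv (by ring)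

/-- With a variance CEILING `Var_c(D) ≤ σ̄²` (all `c`), `Λ(t) − ½t(t−1)δ²σ̄²` is concave on `ℝ`. -/
theorem concaveOn_stepLogMGF_sub_of_varD_le (S₀ D : X → ℝ) (c δ : ℝ) {σbar : ℝ}
    (hσ : ∀ c', varD S₀ D c' ≤ σbar ^ 2) :
    ConcaveOn ℝ univ (fun t => stepLogMGF S₀ D c δ t - t * (t - 1) / 2 * (δ ^ 2 * σbar ^ 2)) := by
  set B := δ ^ 2 * σbar ^ 2 with hB
  have h1 := fun t => (hasDerivAt_stepLogMGF_sub_parabola S₀ D c δ B t).1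
  have h2 := fun t => (hasDerivAt_stepLogMGF_sub_parabola S₀ D c δ B t).2
  have hd : deriv (fun t => stepLogMGF S₀ D c δ t - t * (t - 1) / 2 * B)
      = fun t => (-(meanD S₀ D (c + t * δ) * δ)
          - (linFreeEnergy S₀ D c - linFreeEnergy S₀ D (c + δ))) - (2 * t - 1) / 2 * B :=
    funext fun t => (h1 t).deriv
  refine concaveOn_univ_of_deriv2_nonpos (fun t => (h1 t).differentiableAt)
    (fun t => by rw [hd]; exact (h2 t).differentiableAt) fun t => ?_
  simp only [Function.iterate_succ, Function.iterate_zero, Function.comp_apply, Function.id_def]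
  rw [hd, (h2 t).deriv, hB]
  nlinarith [hσ (c + t * δ), sq_nonneg δ]

/-- With a variance FLOOR `σ_min² ≤ Var_c(D)` (all `c`), `Λ(t) − ½t(t−1)δ²σ_min²` is convex on `ℝ`. -/
theorem convexOn_stepLogMGF_sub_of_le_varD (S₀ D : X → ℝ) (c δ : ℝ) {σmin : ℝ}
    (hσ : ∀ c', σmin ^ 2 ≤ varD S₀ D c') :
    ConvexOn ℝ univ (fun t => stepLogMGF S₀ D c δ t - t * (t - 1) / 2 * (δ ^ 2 * σmin ^ 2)) := by
  set B := δ ^ 2 * σmin ^ 2 with hB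
  have h1 := fun t => (hasDerivAt_stepLogMGF_sub_parabola S₀ D c δ B t).1
  have h2 := fun t => (hasDerivAt_stepLogMGF_sub_parabola S₀ D c δ B t).2
  have hd : deriv (fun t => stepLogMGF S₀ D c δ t - t * (t - 1) / 2 * B)
      = fun t => (-(meanD S₀ D (c + t * δ) * δ)
          - (linFreeEnergy S₀ D c - linFreeEnergy S₀ D (c + δ))) - (2 * t - 1) / 2 * B :=
    funext fun t => (h1 t).deriv
  refine convexOn_univ_of_deriv2_nonneg (fun t => (h1 t).differentiableAt)
    (fun t => by rw [hd]; exact (h2 t).differentiableAt) fun t => ?_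
  simp only [Function.iterate_succ, Function.iterate_zero, Function.comp_apply, Function.id_def]
  rw [hd, (h2 t).deriv, hB]
  nlinarith [hσ (c + t * δ), sq_nonneg δ]

/-- A concave function on `ℝ` vanishing at `0` and `1` is non-negative on `[0,1]`. -/
theorem nonneg_of_concaveOn_of_zeros {ψ : ℝ → ℝ} (hconc : ConcaveOn ℝ univ ψ) (h0 : ψ 0 = 0)
    (h1 : ψ 1 = 0) {t : ℝ} (ht0 : 0 ≤ t) (ht1 : t ≤ 1) : 0 ≤ ψ t := by
  have h := hconc.2 (mem_univ (0:ℝ)) (mem_univ (1:ℝ)) (by linarith : 0 ≤ 1 - t) ht0 (by ring)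
  simp only [smul_eq_mul, mul_zero, mul_one, zero_add, h0, h1] at h
  simpa using h

/-- A convex function on `ℝ` vanishing at `0` and `1` is non-positive on `[0,1]`. -/
theorem nonpos_of_convexOn_of_zeros {φ : ℝ → ℝ} (hconv : ConvexOn ℝ univ φ) (h0 : φ 0 = 0)
    (h1 : φ 1 = 0) {t : ℝ} (ht0 : 0 ≤ t) (ht1 : t ≤ 1) : φ t ≤ 0 := by
  have h := hconv.2 (mem_univ (0:ℝ)) (mem_univ (1:ℝ)) (by linarith : 0 ≤ 1 - t) ht0 (by ring)
  simp only [smul_eq_mul, mul_zero, mul_one, zero_add, h0, h1] at h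
  simpa using h

/-- A convex function on `ℝ` vanishing at `0` and `1` is non-negative off `(0,1)`. -/
theorem nonneg_of_convexOn_of_zeros {φ : ℝ → ℝ} (hconv : ConvexOn ℝ univ φ) (h0 : φ 0 = 0)
    (h1 : φ 1 = 0) {t : ℝ} (ht : t ≤ 0 ∨ 1 ≤ t) : 0 ≤ φ t := by
  rcases ht with ht | ht
  · rcases eq_or_lt_of_le ht with rfl | ht'
    · rw [h0]
    have hden : 0 < 1 - t := by linarith
    have h := hconv.2 (mem_univ t) (mem_univ (1:ℝ)) (div_nonneg zero_le_one hden.le)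
      (div_nonneg (by linarith : 0 ≤ -t) hden.le) (by field_simp; ring)
    have e : (1 / (1 - t)) • t + (-t / (1 - t)) • (1:ℝ) = 0 := by
      simp only [smul_eq_mul]; field_simp; ring
    rw [e, h0] at h
    simp only [smul_eq_mul, h1, mul_zero, add_zero] at h
    have hpos : 0 < 1 / (1 - t) := by positivity
    by_contra hneg
    have := mul_neg_of_pos_of_neg hpos (lt_of_not_ge hneg)
    linarith
  · rcases eq_or_lt_of_le ht with rfl | ht'
    · rw [h1]
    have ht0 : 0 < t := by linarith
    have h := hconv.2 (mem_univ (0:ℝ)) (mem_univ t) (by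
        have : 1 / t ≤ 1 := by rw [div_le_one ht0]; exact ht
        linarith : 0 ≤ 1 - 1 / t)
      (div_nonneg zero_le_one ht0.le) (by ring)
    have e : (1 - 1 / t) • (0:ℝ) + (1 / t) • t = 1 := by
      simp only [smul_eq_mul, mul_zero, zero_add]; field_simp
    rw [e, h1] at h
    simp only [smul_eq_mul, h0, mul_zero, zero_add] at h
    have hpos : 0 < 1 / t := by positivity
    by_contra hneg
    have := mul_neg_of_pos_of_neg hpos (lt_of_not_ge hneg)
    linarith

/-- **THE LOWER PARABOLA ON `[0,1]` FROM A VARIANCE CEILING.**  If `Var_c(D) ≤ σ̄²` for all `c`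
then for `0 ≤ t ≤ 1`: `½t(t−1)·δ²σ̄² ≤ Λ_{c,δ}(t)` (so `|Λ(t)| ≤ ½t(1−t)δ²σ̄²` there, with
`stepLogMGF_nonpos`). -/
theorem stepLogMGF_ge_of_varD_le (S₀ D : X → ℝ) (c δ : ℝ) {σbar : ℝ}
    (hσ : ∀ c', varD S₀ D c' ≤ σbar ^ 2) {t : ℝ} (ht0 : 0 ≤ t) (ht1 : t ≤ 1) :
    t * (t - 1) / 2 * (δ ^ 2 * σbar ^ 2) ≤ stepLogMGF S₀ D c δ t := by
  have h := nonneg_of_concaveOn_of_zeros (concaveOn_stepLogMGF_sub_of_varD_le S₀ D c δ hσ)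
    (by simp) (by simp) ht0 ht1
  linarith

/-- **THE LOWER PARABOLA OFF `(0,1)` FROM A VARIANCE FLOOR.**  If `σ_min² ≤ Var_c(D)` for all `c`
then for `t ≤ 0` or `1 ≤ t`: `½t(t−1)·δ²σ_min² ≤ Λ_{c,δ}(t)`. -/
theorem stepLogMGF_ge_of_le_varD (S₀ D : X → ℝ) (c δ : ℝ) {σmin : ℝ}
    (hσ : ∀ c', σmin ^ 2 ≤ varD S₀ D c') {t : ℝ} (ht : t ≤ 0 ∨ 1 ≤ t) :
    t * (t - 1) / 2 * (δ ^ 2 * σmin ^ 2) ≤ stepLogMGF S₀ D c δ t := by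
  have h := nonneg_of_convexOn_of_zeros (convexOn_stepLogMGF_sub_of_le_varD S₀ D c δ hσ)
    (by simp) (by simp) ht
  linarith

/-- **THE UPPER PARABOLA ON `[0,1]` FROM A VARIANCE FLOOR.**  If `σ_min² ≤ Var_c(D)` for all `c`
then for `0 ≤ t ≤ 1`: `Λ_{c,δ}(t) ≤ ½t(t−1)·δ²σ_min²` (a strict improvement of `Λ ≤ 0`). -/
theorem stepLogMGF_le_of_le_varD (S₀ D : X → ℝ) (c δ : ℝ) {σmin : ℝ}
    (hσ : ∀ c', σmin ^ 2 ≤ varD S₀ D c') {t : ℝ} (ht0 : 0 ≤ t) (ht1 : t ≤ 1) :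
    stepLogMGF S₀ D c δ t ≤ t * (t - 1) / 2 * (δ ^ 2 * σmin ^ 2) := by
  have h := nonpos_of_convexOn_of_zeros (convexOn_stepLogMGF_sub_of_le_varD S₀ D c δ hσ)
    (by simp) (by simp) ht0 ht1
  linarith

/-- **`χ²` FLOOR INSIDE THE FAMILY**: `e^{a²σ_min²} − 1 ≤ χ²(π_{c+a} ‖ π_c)` when
`σ_min² ≤ Var_{c'}(D)` for every `c'` (the floor matching `chiSqDiv_gibbsLaw_linAction_le`). -/
theorem chiSqDiv_gibbsLaw_linAction_ge (S₀ D : X → ℝ) (c a : ℝ) {σmin : ℝ}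
    (hσ : ∀ c', σmin ^ 2 ≤ varD S₀ D c') :
    Real.exp (a ^ 2 * σmin ^ 2) - 1
      ≤ chiSqDiv (gibbsLaw (linAction S₀ D (c + a))) (gibbsLaw (linAction S₀ D c)) := by
  rw [chiSqDiv_gibbsLaw_linAction_eq]
  have h := stepLogMGF_ge_of_le_varD S₀ D c a hσ (t := 2) (Or.inr (by norm_num))
  have h' : a ^ 2 * σmin ^ 2 ≤ stepLogMGF S₀ D c a 2 := by linarith
  linarith [Real.exp_le_exp.mpr h']

end Summit.Ventures.LatticeQCDFlow.Scaling
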